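import Summits.KontsevichZagierPeriods.KontsevichZagierPeriods.Theorems.HurwitzMicroSectorsHurwitzSectorComplementStubTowerReductionOfPTS
import Summits.KontsevichZagierPeriods.KontsevichZagierPeriods.Theorems.HurwitzMicroSectorsHurwitzSectorComplementParityTowerSector

/-!
# `HurwitzSectorComplement` (stmt-KontsevichZagierPeriods-14341), line `chebyshev-level-deformation`:
# `stub_towerReduction` — the twisted parity tower, unconditionally

The registered stub S6 of the gen-1 skeleton (twisted Bernoulli-parity cyclotomic kernel pairs,
`TwistedParityTower` of SketchIdeator2 sharpened to cyclotomic `c₀`), from the landed sector theorem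
`parityTowerSector` and the landed reduction `stub_towerReduction_of_parityTowerSector`.
Reference: M. Kontsevich, D. Zagier, *Periods* (2001), §1.2.
-/

noncomputable section

open Set MeasureTheory
open scoped BigOperators
open Literature.NumberTheory.Transcendental

namespace Summit.KontsevichZagierPeriods.Theorems.HurwitzMicroSectorsHurwitzSectorComplement

/-- **The twisted parity tower** (stub S6 of the gen-1 skeleton of line `chebyshev-level-deformation`):
any two twisted Bernoulli-parity cyclotomic kernel representations
`[(0,1)^{k+2} × (0,α), K_{cos(2πa/N)}(x₁⋯x_{k+2})]` (`α > 0` real algebraic, `0 ≤ 2a ≤ N`) with equal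
values are KZ-equivalent. [cite: KontsevichZagier2001, §1.2 Conjecture 1] -/
theorem stub_towerReduction : ∀ (k k' N a N' a' : ℕ) (α α' : ℝ), 0 < N → 2 * a ≤ N → 0 < N' → 2 * a' ≤ N' → IsAlgebraic ℚ α → IsAlgebraic ℚ α' → 0 < α → 0 < α' → ∀ (r : KZ.IntegralRep (k + 3)) (r' : KZ.IntegralRep (k' + 3)), r.domain = {z | (∀ i : Fin (k + 2), z (Fin.castSucc i) ∈ Set.Ioo (0:ℝ) 1) ∧ z (Fin.last (k + 2)) ∈ Set.Ioo 0 α} → Set.EqOn r.integrand (fun z => if Even k then (Real.cos (2 * Real.pi * a / N) - ∏ i : Fin (k + 2), z (Fin.castSucc i)) / (1 - 2 * Real.cos (2 * Real.pi * a / N) * (∏ i : Fin (k + 2), z (Fin.castSucc i)) + (∏ i : Fin (k + 2), z (Fin.castSucc i)) ^ 2) else Real.sqrt (1 - Real.cos (2 * Real.pi * a / N) ^ 2) / (1 - 2 * Real.cos (2 * Real.pi * a / N) * (∏ i : Fin (k + 2), z (Fin.castSucc i)) + (∏ i : Fin (k + 2), z (Fin.castSucc i)) ^ 2)) r.domain →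 r'.domain = {z | (∀ i : Fin (k' + 2), z (Fin.castSucc i) ∈ Set.Ioo (0:ℝ) 1) ∧ z (Fin.last (k' + 2)) ∈ Set.Ioo 0 α'} → Set.EqOn r'.integrand (fun z => if Even k' then (Real.cos (2 * Real.pi * a' / N') - ∏ i : Fin (k' + 2), z (Fin.castSucc i)) / (1 - 2 * Real.cos (2 * Real.pi * a' / N') * (∏ i : Fin (k' + 2), z (Fin.castSucc i)) + (∏ i : Fin (k' + 2), z (Fin.castSucc i)) ^ 2) else Real.sqrt (1 - Real.cos (2 * Real.pi * a' / N') ^ 2) / (1 - 2 * Real.cos (2 * Real.pi * a' / N') * (∏ i : Fin (k' + 2), z (Fin.castSucc i)) + (∏ i : Fin (k' + 2), z (Fin.castSucc i)) ^ 2)) r'.domain → r.value = r'.value → KZ.Equivalent r r' :=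
  stub_towerReduction_of_parityTowerSector parityTowerSector

end Summit.KontsevichZagierPeriods.Theorems.HurwitzMicroSectorsHurwitzSectorComplement

end
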